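import Summits.AnomalousDissipation.AnomalousDissipation.Theses.HopfSnake
import Literature.Analysis.FluidPDE.TorusClassicalLerayHopfProofs
import Literature.Analysis.FunctionSpaces.TorusClassicalNSGluing
import Literature.Analysis.FunctionSpaces.TorusSpaceTime

/-!
# `HopfSnake.PeriodicOrbitsEnstrophyBound` (item stmt-AnomalousDissipation-1804): the provable core

The support item `PeriodicOrbitsEnstrophyBound` of route `HopfSnake` asks, at FIXED viscosity
`ν > 0` and smooth steady divergence-free mean-zero force `f` on `T³`, for a bound
`‖∇u(t)‖₂² ≤ C(ν, f, R)` valid for ALL `t` and ALL mean-zero time-periodic classical solutions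
`u` of `NS_ν(f)` with kinetic energy `≤ R` — uniformly over the solutions and their periods.
Pointwise-in-time uniform `H¹` control of bounded-energy solutions of the three-dimensional
Navier–Stokes system is a (quantitative) global-regularity statement and is open; this file lands
the part that IS a theorem, serving the item without closing it:

* `integral_inner_le_half_normSq_add_kineticEnergy` — the injected power is controlled by the
  energy: `∫ ⟪f, v⟫ ≤ ½‖f‖₂² + E(v)` (Cauchy–Schwarz/Young pointwise);
* `kineticEnergy_add_dissipation_le` — energy bookkeeping on a time window `[a, a + τ]` for a
  global classical solution with `E(u(t)) ≤ R`:
  `E(u(a+τ)) + ν ∫ₐ^{a+τ} ‖∇u‖₂² ≤ E(u(a)) + τ (½‖f‖₂² + R)` (the tree's energy equality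
  `Torus.IsClassicalNSSolutionOn.energy_eq`);
* `periodic_dissipation_le` — for a `T`-periodic such solution the dissipation over one period is
  a priori bounded, `ν ∫ₐ^{a+T} ‖∇u‖₂² ≤ T (½‖f‖₂² + R)`: the PERIOD-MEAN enstrophy bound, which
  is the true a-priori content of the item (and all that the energy method gives in 3-D);
* `gradNormSq_le_of_steady` — steady solutions satisfy the item's conclusion outright,
  `‖∇v‖₂² ≤ (½‖f‖₂² + R)/ν`;
* `exists_gradNormSq_le` — GOOD TIMES ARE 1-DENSE: every unit time window `[a, a+1]` contains an
  instant `s` with `‖∇u(s)‖₂² ≤ (2R + ½‖f‖₂²)/ν` (no periodicity needed);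
* `periodicOrbitsEnstrophyBound_of_uniform_propagation` — REDUCTION: the item follows from
  uniform propagation of enstrophy over ONE unit of time among bounded-energy global classical
  solutions (`‖∇u(a)‖₂² ≤ A ⇒ ‖∇u(t)‖₂² ≤ F(ν,f,R,A)` on `[a, a+1]`), i.e. from the forced,
  bounded-energy form of the quantitative regularity statement for periodic Navier–Stokes
  (Tao 2007, "A quantitative formulation of the global regularity problem for the periodic
  Navier–Stokes equation", Conj. 1.4-type a-priori `H¹` bound); periodicity of `u` is not used.
  Local well-posedness supplies such an `F` only on `[a, a + δ(ν,f,A)]`; `δ ≥ 1` holds in the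
  laminar (small `R`, `‖f‖₂` against `ν`) regime, see the sequel file, and is open otherwise.

References: C. Doering, C. Foias, J. Fluid Mech. 467 (2002) §2 (energy balance);
P. Constantin, C. Foias, *Navier–Stokes Equations* (1988), Ch. 9–10; C. Foias, O. Manley, R. Rosa,
R. Temam, *Navier–Stokes Equations and Turbulence* (2001), Ch. II–III; T. Tao, Dyn. PDE 4 (2007)
293–302.
-/

-- `Summit.<Summit>.<Problem>` is the tree's mandated summit-side namespace (CONVENTIONS §2); for this
-- single-conjunct summit the two coincide, so the duplicate is deliberate.
set_option linter.dupNamespace false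

noncomputable section

open scoped BigOperators Topology InnerProductSpace
open Filter Set Function MeasureTheory

namespace Summit.AnomalousDissipation.AnomalousDissipation.Theorems.HopfSnake.PeriodicOrbitsEnstrophyBound

open Literature.Analysis.FunctionSpaces Literature.Analysis.FunctionSpaces.Torus
open Literature.Analysis.FluidPDE

/-! ### Injected power against energy -/

/-- **Injected power is controlled by the energy**: for continuous fields `f`, `v` on `T³`,
`∫ ⟪f, v⟫ ≤ ½ ∫ ‖f‖² + E(v)` with `E(v) = ½ ∫ ‖v‖²` (pointwise `⟪a, b⟫ ≤ ‖a‖‖b‖ ≤ ½‖a‖² + ½‖b‖²`,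
then integrate over the probability space `T³`). [folklore] -/
theorem integral_inner_le_half_normSq_add_kineticEnergy
    {f v : UnitAddTorus (Fin 3) → EuclideanSpace ℝ (Fin 3)} (hf : Continuous f)
    (hv : Continuous v) :
    ∫ x, ⟪f x, v x⟫_ℝ ≤ (2⁻¹ * ∫ x, ‖f x‖ ^ 2) + kineticEnergy v := by
  have hi1 : Integrable (fun x => ⟪f x, v x⟫_ℝ) volume := (hf.inner hv).integrable_unitAddTorus
  have hi2 : Integrable (fun x => ‖f x‖ ^ 2) volume := (hf.norm.pow 2).integrable_unitAddTorus
  have hi3 : Integrable (fun x => ‖v x‖ ^ 2) volume := (hv.norm.pow 2).integrable_unitAddTorus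
  have key : ∫ x, ⟪f x, v x⟫_ℝ ≤ ∫ x, (2⁻¹ * ‖f x‖ ^ 2 + 2⁻¹ * ‖v x‖ ^ 2) := by
    refine integral_mono hi1 ((hi2.const_mul _).add (hi3.const_mul _)) fun x => ?_
    have h1 := real_inner_le_norm (f x) (v x)
    have h2 := two_mul_le_add_sq ‖f x‖ ‖v x‖
    dsimp only
    linarith
  rw [integral_add (hi2.const_mul _) (hi3.const_mul _), integral_const_mul, integral_const_mul]
    at key
  unfold kineticEnergy
  exact key

/-! ### Energy bookkeeping on time windows -/

variable {ν R : ℝ} {f : UnitAddTorus (Fin 3) → EuclideanSpace ℝ (Fin 3)}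
  {u : ℝ → UnitAddTorus (Fin 3) → EuclideanSpace ℝ (Fin 3)} {p : ℝ → UnitAddTorus (Fin 3) → ℝ}

/-- **Energy bookkeeping on a window.** For a global classical solution of `NS_ν(f)` with steady
smooth force and kinetic energy `≤ R` at all times, on every window `[a, a + τ]`:
`E(u(a+τ)) + ν ∫ₐ^{a+τ} ‖∇u‖₂² ≤ E(u(a)) + τ (½‖f‖₂² + R)` — the energy equality
(`Torus.IsClassicalNSSolutionOn.energy_eq`, Doering–Foias 2002 §2 (2.4)) with the injected power
bounded by `integral_inner_le_half_normSq_add_kineticEnergy`. [folklore] -/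
theorem kineticEnergy_add_dissipation_le (hf : IsSmooth f)
    (h : IsClassicalNSSolutionOn univ ν (fun _ => f) u p) (hE : ∀ t, kineticEnergy (u t) ≤ R)
    (a : ℝ) {τ : ℝ} (hτ : 0 ≤ τ) :
    kineticEnergy (u (a + τ)) + ν * ∫ s in a..(a + τ), gradNormSq (u s) ≤
      kineticEnergy (u a) + τ * ((2⁻¹ * ∫ x, ‖f x‖ ^ 2) + R) := by
  have haτ : a ≤ a + τ := by linarith
  have heq := h.energy_eq convex_univ haτ (subset_univ _)
  have hu := h.smooth_velocity
  have hF : IsSmoothSpaceTimeOn univ (fun _ : ℝ => f) := isSmoothSpaceTimeOn_const hf univ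
  have hcont : ContinuousOn (fun s => ∫ x, ⟪f x, u s x⟫_ℝ) univ :=
    (hF.inner hu).continuousOn_integral convex_univ
  have hbound : ∀ s, ∫ x, ⟪f x, u s x⟫_ℝ ≤ (2⁻¹ * ∫ x, ‖f x‖ ^ 2) + R := fun s =>
    (integral_inner_le_half_normSq_add_kineticEnergy hf.continuous
      (hu.isSmooth_slice (mem_univ s)).continuous).trans (by linarith [hE s])
  have hint : ∫ s in a..(a + τ), ∫ x, ⟪f x, u s x⟫_ℝ ≤
      ∫ _ in a..(a + τ), ((2⁻¹ * ∫ x, ‖f x‖ ^ 2) + R) := by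
    refine intervalIntegral.integral_mono_on haτ ?_ intervalIntegrable_const fun s _ => hbound s
    exact (hcont.mono (subset_univ _)).intervalIntegrable_of_Icc haτ
  rw [intervalIntegral.integral_const, smul_eq_mul] at hint
  have hτ' : (a + τ - a) * ((2⁻¹ * ∫ x, ‖f x‖ ^ 2) + R) = τ * ((2⁻¹ * ∫ x, ‖f x‖ ^ 2) + R) := by
    ring
  rw [hτ'] at hint
  beta_reduce at heq
  linarith

/-- The same bookkeeping with `E(u(a)) ≤ R` inserted:
`E(u(a+τ)) + ν ∫ₐ^{a+τ} ‖∇u‖₂² ≤ R + τ (½‖f‖₂² + R)`. [folklore] -/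
theorem kineticEnergy_add_dissipation_le' (hf : IsSmooth f)
    (h : IsClassicalNSSolutionOn univ ν (fun _ => f) u p) (hE : ∀ t, kineticEnergy (u t) ≤ R)
    (a : ℝ) {τ : ℝ} (hτ : 0 ≤ τ) :
    kineticEnergy (u (a + τ)) + ν * ∫ s in a..(a + τ), gradNormSq (u s) ≤
      R + τ * ((2⁻¹ * ∫ x, ‖f x‖ ^ 2) + R) := by
  have := kineticEnergy_add_dissipation_le hf h hE a hτ
  linarith [hE a]

/-- **Period-mean enstrophy bound** (the a-priori content of the item): for a `T`-periodic global
classical solution of `NS_ν(f)` with kinetic energy `≤ R`, the dissipation over one period is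
bounded uniformly in the solution, `ν ∫ₐ^{a+T} ‖∇u‖₂² ≤ T (½‖f‖₂² + R)`; equivalently the
period mean of `‖∇u‖₂²` is at most `(½‖f‖₂² + R)/ν` (energy equality over a period, the boundary
terms cancelling by periodicity; Doering–Foias 2002 §2). [folklore] -/
theorem periodic_dissipation_le {T : ℝ} (hf : IsSmooth f)
    (h : IsClassicalNSSolutionOn univ ν (fun _ => f) u p) (hper : Function.Periodic u T)
    (hT : 0 ≤ T) (hE : ∀ t, kineticEnergy (u t) ≤ R) (a : ℝ) :
    ν * ∫ s in a..(a + T), gradNormSq (u s) ≤ T * ((2⁻¹ * ∫ x, ‖f x‖ ^ 2) + R) := by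
  have := kineticEnergy_add_dissipation_le hf h hE a hT
  rw [hper a] at this
  linarith

/-- **Steady solutions satisfy the item's conclusion**: a time-independent global classical
solution `v` of `NS_ν(f)`, `ν > 0`, with `E(v) ≤ R` has `‖∇v‖₂² ≤ (½‖f‖₂² + R)/ν`
(`periodic_dissipation_le` with period `1`; cf. `ν‖∇v‖₂² = ∫ ⟪f, v⟫`). [folklore] -/
theorem gradNormSq_le_of_steady (hν : 0 < ν) {v : UnitAddTorus (Fin 3) → EuclideanSpace ℝ (Fin 3)}
    (hf : IsSmooth f) (h : IsClassicalNSSolutionOn univ ν (fun _ => f) (fun _ => v) p)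
    (hE : kineticEnergy v ≤ R) :
    gradNormSq v ≤ ((2⁻¹ * ∫ x, ‖f x‖ ^ 2) + R) / ν := by
  have hper : Function.Periodic (fun _ : ℝ => v) 1 := fun _ => rfl
  have h1 := periodic_dissipation_le hf h hper zero_le_one (fun _ => hE) 0
  rw [intervalIntegral.integral_const, smul_eq_mul] at h1
  rw [le_div_iff₀ hν]
  linarith

/-! ### Good times are `1`-dense -/

/-- **Good times in every unit window.** For a global classical solution of `NS_ν(f)`, `ν > 0`,
with kinetic energy `≤ R` at all times, every window `[a, a + 1]` contains an instant `s` with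
`‖∇u(s)‖₂² ≤ (2R + ½‖f‖₂²)/ν`: otherwise the continuous `s ↦ ‖∇u(s)‖₂²` would exceed this
level throughout the window and `ν ∫ₐ^{a+1} ‖∇u‖₂² > 2R + ½‖f‖₂²`, contradicting
`kineticEnergy_add_dissipation_le'` (with `E ≥ 0`). No periodicity is used. [folklore] -/
theorem exists_gradNormSq_le (hν : 0 < ν) (hf : IsSmooth f)
    (h : IsClassicalNSSolutionOn univ ν (fun _ => f) u p) (hE : ∀ t, kineticEnergy (u t) ≤ R)
    (a : ℝ) :
    ∃ s ∈ Icc a (a + 1), gradNormSq (u s) ≤ (2 * R + 2⁻¹ * ∫ x, ‖f x‖ ^ 2) / ν := by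
  set M : ℝ := (2 * R + 2⁻¹ * ∫ x, ‖f x‖ ^ 2) / ν with hM
  by_contra H
  push Not at H
  have ha1 : a < a + 1 := by linarith
  have hwin := kineticEnergy_add_dissipation_le' hf h hE a zero_le_one
  have hE0 := kineticEnergy_nonneg (u (a + 1))
  have hcont : ContinuousOn (fun s => gradNormSq (u s)) (Icc a (a + 1)) :=
    (h.smooth_velocity.continuousOn_gradNormSq convex_univ uniqueDiffOn_univ).mono (subset_univ _)
  have haI : a ∈ Icc a (a + 1) := left_mem_Icc.2 ha1.le
  have hlt : ∫ _ in a..(a + 1), M < ∫ s in a..(a + 1), gradNormSq (u s) :=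
    intervalIntegral.integral_lt_integral_of_continuousOn_of_le_of_exists_lt ha1 continuousOn_const
      hcont (fun s hs => (H s (Ioc_subset_Icc_self hs)).le) ⟨a, haI, H a haI⟩
  rw [intervalIntegral.integral_const, smul_eq_mul] at hlt
  have h1 : (a + 1 - a) * M = M := by ring
  rw [h1] at hlt
  have hνM : ν * M = 2 * R + 2⁻¹ * ∫ x, ‖f x‖ ^ 2 := by
    rw [hM]; field_simp
  have h2 : ν * M < ν * ∫ s in a..(a + 1), gradNormSq (u s) := mul_lt_mul_of_pos_left hlt hν
  linarith

/-! ### Reduction of the item to uniform unit-time propagation of enstrophy -/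

/-- **Reduction.** `PeriodicOrbitsEnstrophyBound` follows from UNIFORM PROPAGATION OF ENSTROPHY
OVER ONE UNIT OF TIME among mean-zero bounded-energy global classical solutions of `NS_ν(f)`:
if for all `ν > 0`, smooth steady divergence-free mean-zero `f`, `R` and `A` there is `F` with
`‖∇u(a)‖₂² ≤ A ⇒ ‖∇u(t)‖₂² ≤ F` for `t ∈ [a, a+1]` and every such solution `u` with energy `≤ R`,
then the item holds with `C = F(ν, f, R, (2R + ½‖f‖₂²)/ν)`: by `exists_gradNormSq_le` every `t`
lies within one time unit after a good instant `s ∈ [t-1, t]`. Periodicity of `u` is not needed.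
The hypothesis is the forced, bounded-energy form of the quantitative (a-priori `H¹`) regularity
statement for the space-periodic Navier–Stokes system (Tao 2007, Dyn. PDE 4, Conj. 1.4 type), known
only for short windows `[a, a + δ(ν, f, A)]` (local well-posedness) — this is where the item is
open in three dimensions. [folklore] -/
theorem periodicOrbitsEnstrophyBound_of_uniform_propagation
    (H : ∀ ν : ℝ, 0 < ν → ∀ f : UnitAddTorus (Fin 3) → EuclideanSpace ℝ (Fin 3),
      IsSmooth f → IsDivFree f → HasZeroMean f → ∀ R A : ℝ, ∃ F : ℝ,
        ∀ (u : ℝ → UnitAddTorus (Fin 3) → EuclideanSpace ℝ (Fin 3))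
          (p : ℝ → UnitAddTorus (Fin 3) → ℝ) (a : ℝ),
          IsClassicalNSSolutionOn Set.univ ν (fun _ => f) u p → (∀ t, HasZeroMean (u t)) →
            (∀ t, kineticEnergy (u t) ≤ R) → gradNormSq (u a) ≤ A →
              ∀ t ∈ Set.Icc a (a + 1), gradNormSq (u t) ≤ F) :
    Summit.AnomalousDissipation.AnomalousDissipation.Theses.HopfSnake.PeriodicOrbitsEnstrophyBound := by
  intro ν hν f hf hdiv hmean R
  obtain ⟨F, hF⟩ := H ν hν f hf hdiv hmean R ((2 * R + 2⁻¹ * ∫ x, ‖f x‖ ^ 2) / ν)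
  refine ⟨F, fun u p T hsol hmz _ _ hE t => ?_⟩
  obtain ⟨s, hs, hsA⟩ := exists_gradNormSq_le hν hf hsol hE (t - 1)
  exact hF u p s hsol hmz hE hsA t ⟨by linarith [hs.2], by linarith [hs.1]⟩

end Summit.AnomalousDissipation.AnomalousDissipation.Theorems.HopfSnake.PeriodicOrbitsEnstrophyBound

end
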